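import Mathlib
import HarnessLib
import Summits.ValiantsHypothesis.ValiantsHypothesis.Theorems.KPlusLogSqLawWeakLiftingTowerGraftWronskianKFourLevelTables

/-!
# Tower graft line — CONJECTURE W AT `K = 4`: THE POLES `ρ₁, ρ₂, ρ₃` (unique positive roots of `U₁, U₂, U₃` and their sign structure)

Helper file for LINE (B) `Cruxes/WeakLifting/Lines/tower_graft.lean` (crux `WeakLifting` = stmt-ValiantsHypothesis-19561): the first
ANALYTIC brick of the lap calculus of hand g11's memo (`evidence-g11-conjectureW-K4-levels.md` on the item), after the algebraic files
`…WronskianKFourLevels` / `…KFourFifthZero` / `…KFourQuotients` / `…KFourLevelTables`.  NO stub is claimed.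

* `eval_lt_zero_of_top_neg`, `eval_lt_zero_of_third_neg` — explicit points where such a `4`-nomial is negative;
* ★ `fewnomial_four_unique_pos_root` — a `4`-nomial `Σ wₗ X^{dₗ}` on a strictly increasing support with ONE weak sign change,
  `w₀ > 0`, `w₁ ≥ 0` and (`w₂ ≥ 0`, `w₃ < 0`) or (`w₂ < 0`, `w₃ ≤ 0`), has a positive root `ρ` with `P > 0` on `(0,ρ)` and `P < 0` on
  `(ρ,∞)` (hence exactly one positive root): Descartes with multiplicity (`…KFourLevels`, `…KFourQuotients`) + the intermediate value
  theorem;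
* ★ `special_one_root_structure`, `special_two_root_structure`, `special_three_root_structure` — on the fully alternating Plücker cell
  the distinguished members `U₁ = v₁u − u₁v`, `U₂`, `U₃` each have such a root `ρ_k`, with the sign-invariant orientation
  `p₀₁·U₁ > 0`, `p₀₂·U₂ > 0`, `p₀₃·U₃ > 0` before `ρ_k` and `< 0` after (`p₀ₖ = u₀v_k − u_k v₀`).

(The poles and side orientations of the quotients in the memo's §1–§2.)  HONEST FRAMING: Conjecture W at `K = 4` remains OPEN; nothing
on S4/S4f/S5/S5ᴸ, TowerB, `WeakLifting`, Conjecture B, `MatrixDescartes` (18050), `VP ≠ VNP`.  Def-free.  Seat: prover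
leafhand-val-kpluslogsqlaw-1 g11, `--supports stmt-ValiantsHypothesis-19561 --as helper`.  [folklore: Descartes + IVT]
-/

-- `Summit.ValiantsHypothesis.ValiantsHypothesis.…` repeats a component by the D-0017 layout
-- (single-conjunct summit), which the `dupNamespace` linter flags; the name is mandated.
set_option linter.dupNamespace false
set_option autoImplicit false

namespace Summit.ValiantsHypothesis.ValiantsHypothesis.Theorems.KPlusLogSqLaw.TowerGraft

open Polynomial Finset
open scoped BigOperators Polynomial
open Summit.ValiantsHypothesis.ValiantsHypothesis.Theorems.LacunarySymmetroidMatrixDescartes.Census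
  (mul_pos_of_mul_neg_of_mul_neg mul_neg_of_mul_pos_of_mul_neg)

namespace WronskianDevelopable

/-! ## §1 Explicit negative values far out -/

/-- **case «top coefficient negative»**: if `w₃ < 0` then at `x = 1 + (|w₀|+|w₁|+|w₂|)/(−w₃)` the `4`-nomial is negative. [folklore] -/
theorem eval_lt_zero_of_top_neg (w : Fin 4 → ℝ) (e : Fin 4 → ℕ) (he : StrictMono e) (h3 : w 3 < 0) :
    (∑ l, C (w l) * (X : ℝ[X]) ^ e l).eval (1 + (|w 0| + |w 1| + |w 2|) / (-w 3)) < 0 := by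
  set S : ℝ := |w 0| + |w 1| + |w 2| with hS
  set x : ℝ := 1 + S / (-w 3) with hx
  have hS0 : 0 ≤ S := by positivity
  have hw3 : 0 < -w 3 := by linarith
  have hx1 : 1 ≤ x := by
    have : 0 ≤ S / (-w 3) := div_nonneg hS0 hw3.le
    linarith
  have hx0 : 0 < x := by linarith
  have e02 : e 0 ≤ e 2 := (he.monotone (by decide))
  have e12 : e 1 ≤ e 2 := (he.monotone (by decide))
  have e23 : e 2 + 1 ≤ e 3 := he (show (2 : Fin 4) < 3 by decide)
  rw [eval_fewnomial]
  simp only [Fin.sum_univ_four]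
  -- bound the three lower terms by `|w l|·x^{e₂}`
  have b0 : w 0 * x ^ e 0 ≤ |w 0| * x ^ e 2 :=
    (mul_le_mul_of_nonneg_right (le_abs_self _) (pow_nonneg hx0.le _)).trans
      (mul_le_mul_of_nonneg_left (pow_le_pow_right₀ hx1 e02) (abs_nonneg _))
  have b1 : w 1 * x ^ e 1 ≤ |w 1| * x ^ e 2 :=
    (mul_le_mul_of_nonneg_right (le_abs_self _) (pow_nonneg hx0.le _)).trans
      (mul_le_mul_of_nonneg_left (pow_le_pow_right₀ hx1 e12) (abs_nonneg _))
  have b2 : w 2 * x ^ e 2 ≤ |w 2| * x ^ e 2 := mul_le_mul_of_nonneg_right (le_abs_self _) (pow_nonneg hx0.le _)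
  -- the top term: `w₃ x^{e₃} ≤ w₃ · x^{e₂} · x`
  have b3 : w 3 * x ^ e 3 ≤ w 3 * (x ^ e 2 * x) := by
    have : x ^ e 2 * x ≤ x ^ e 3 := by
      rw [← pow_succ]; exact pow_le_pow_right₀ hx1 e23
    exact mul_le_mul_of_nonpos_left this h3.le
  have key : S * x ^ e 2 + w 3 * (x ^ e 2 * x) < 0 := by
    have hx2 : 0 < x ^ e 2 := pow_pos hx0 _
    have hw3ne : w 3 ≠ 0 := ne_of_lt h3
    have : S + w 3 * x = w 3 := by
      have : w 3 * x = w 3 - S := by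
        rw [hx, mul_add, mul_one]
        have : w 3 * (S / -w 3) = -S := by
          rw [div_neg, mul_neg, mul_div_cancel₀ S hw3ne]
        rw [this]; ring
      linarith
    nlinarith
  linarith

/-- **case «third coefficient negative, top nonpositive»**: if `w₂ < 0` and `w₃ ≤ 0` then at `x = 1 + (|w₀|+|w₁|)/(−w₂)` the
`4`-nomial is negative. [folklore] -/
theorem eval_lt_zero_of_third_neg (w : Fin 4 → ℝ) (e : Fin 4 → ℕ) (he : StrictMono e) (h2 : w 2 < 0) (h3 : w 3 ≤ 0) :
    (∑ l, C (w l) * (X : ℝ[X]) ^ e l).eval (1 + (|w 0| + |w 1|) / (-w 2)) < 0 := by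
  set S : ℝ := |w 0| + |w 1| with hS
  set x : ℝ := 1 + S / (-w 2) with hx
  have hS0 : 0 ≤ S := by positivity
  have hw2 : 0 < -w 2 := by linarith
  have hx1 : 1 ≤ x := by
    have : 0 ≤ S / (-w 2) := div_nonneg hS0 hw2.le
    linarith
  have hx0 : 0 < x := by linarith
  have e01 : e 0 ≤ e 1 := (he.monotone (by decide))
  have e12 : e 1 + 1 ≤ e 2 := he (show (1 : Fin 4) < 2 by decide)
  rw [eval_fewnomial]
  simp only [Fin.sum_univ_four]
  have b0 : w 0 * x ^ e 0 ≤ |w 0| * x ^ e 1 :=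
    (mul_le_mul_of_nonneg_right (le_abs_self _) (pow_nonneg hx0.le _)).trans
      (mul_le_mul_of_nonneg_left (pow_le_pow_right₀ hx1 e01) (abs_nonneg _))
  have b1 : w 1 * x ^ e 1 ≤ |w 1| * x ^ e 1 := mul_le_mul_of_nonneg_right (le_abs_self _) (pow_nonneg hx0.le _)
  have b2 : w 2 * x ^ e 2 ≤ w 2 * (x ^ e 1 * x) := by
    have : x ^ e 1 * x ≤ x ^ e 2 := by
      rw [← pow_succ]; exact pow_le_pow_right₀ hx1 e12
    exact mul_le_mul_of_nonpos_left this h2.le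
  have b3 : w 3 * x ^ e 3 ≤ 0 := mul_nonpos_of_nonpos_of_nonneg h3 (pow_nonneg hx0.le _)
  have key : S * x ^ e 1 + w 2 * (x ^ e 1 * x) < 0 := by
    have hx2 : 0 < x ^ e 1 := pow_pos hx0 _
    have hw2ne : w 2 ≠ 0 := ne_of_lt h2
    have : S + w 2 * x = w 2 := by
      have : w 2 * x = w 2 - S := by
        rw [hx, mul_add, mul_one]
        have : w 2 * (S / -w 2) = -S := by
          rw [div_neg, mul_neg, mul_div_cancel₀ S hw2ne]
        rw [this]; ring
      linarith
    nlinarith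
  linarith

/-! ## §2 One weak sign change: the unique positive root and the sign structure -/

/-- two distinct positive roots cost two in the multiplicity count. [folklore] -/
theorem two_le_countP_posRoots_of_two_roots (f : ℝ[X]) (hf : f ≠ 0) {x y : ℝ} (hx : 0 < x) (hy : 0 < y) (hxy : x ≠ y)
    (hfx : f.eval x = 0) (hfy : f.eval y = 0) : 2 ≤ f.roots.countP (fun t => 0 < t) := by
  classical
  have hsub : ({x, y} : Multiset ℝ) ≤ f.roots := by
    rw [Multiset.le_iff_subset (by simp [hxy])]
    intro t ht
    have ht' : t = x ∨ t = y := by simpa using ht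
    rcases ht' with rfl | rfl
    · exact (mem_roots hf).mpr hfx
    · exact (mem_roots hf).mpr hfy
  have h2 : ({x, y} : Multiset ℝ).countP (fun t => 0 < t) = 2 := by
    rw [Multiset.countP_eq_card_filter, Multiset.filter_eq_self.mpr]
    · simp
    · intro t ht
      have ht' : t = x ∨ t = y := by simpa using ht
      rcases ht' with rfl | rfl
      · exact hx
      · exact hy
  calc 2 = ({x, y} : Multiset ℝ).countP (fun t => 0 < t) := h2.symm
    _ ≤ f.roots.countP (fun t => 0 < t) := Multiset.countP_le_of_le _ hsub

/-- ★ **ONE WEAK SIGN CHANGE ⇒ UNIQUE POSITIVE ROOT WITH SIGN STRUCTURE.**  Let `P = Σₗ wₗ X^{dₗ}` (`l < 4`, `d` strictly increasing)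
with `w₀ > 0`, `w₁ ≥ 0` and either (`w₂ ≥ 0`, `w₃ < 0`) or (`w₂ < 0`, `w₃ ≤ 0`).  Then there is `ρ > 0` with `P(ρ) = 0`, `P > 0`
on `(0, ρ)` and `P < 0` on `(ρ, ∞)`. [folklore; kernel form this work] -/
theorem fewnomial_four_unique_pos_root (w : Fin 4 → ℝ) (d : Fin 4 → ℕ) (hd : StrictMono d) (h0 : 0 < w 0) (h1 : 0 ≤ w 1)
    (h23 : (0 ≤ w 2 ∧ w 3 < 0) ∨ (w 2 < 0 ∧ w 3 ≤ 0)) :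
    ∃ ρ : ℝ, 0 < ρ ∧ (∑ l, C (w l) * (X : ℝ[X]) ^ d l).eval ρ = 0 ∧
      (∀ x : ℝ, 0 < x → x < ρ → 0 < (∑ l, C (w l) * (X : ℝ[X]) ^ d l).eval x) ∧
      (∀ x : ℝ, ρ < x → (∑ l, C (w l) * (X : ℝ[X]) ^ d l).eval x < 0) := by
  classical
  -- shifted exponents `e l = d l − d 0`, `P = X^{d₀} · Q`
  set e : Fin 4 → ℕ := fun l => d l - d 0 with he
  have hmono : Monotone d := hd.monotone
  have hE : StrictMono e := by
    intro i j hij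
    have h1 := hd hij; have h2 := hmono (Fin.zero_le i)
    show d i - d 0 < d j - d 0; omega
  have he0 : e 0 = 0 := by simp [he]
  set Q : ℝ[X] := ∑ l, C (w l) * (X : ℝ[X]) ^ e l with hQ
  have hPQ : (∑ l, C (w l) * (X : ℝ[X]) ^ d l) = X ^ d 0 * Q := by
    rw [hQ, Finset.mul_sum]
    refine Finset.sum_congr rfl fun l _ => ?_
    have : d l = d 0 + e l := by
      have := hmono (Fin.zero_le l); simp [he]; omega
    rw [this, pow_add]; ring
  have hevalP : ∀ x : ℝ, (∑ l, C (w l) * (X : ℝ[X]) ^ d l).eval x = x ^ d 0 * Q.eval x := by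
    intro x; rw [hPQ, eval_mul, eval_pow, eval_X]
  -- `Q(0) = w₀ > 0`
  have hQ0 : Q.eval 0 = w 0 := by
    rw [hQ, eval_fewnomial]
    simp only [Fin.sum_univ_four, he0, pow_zero, mul_one]
    have h1' : e 1 ≠ 0 := Nat.pos_iff_ne_zero.mp (by have := hE (show (0:Fin 4) < 1 by decide); omega)
    have h2' : e 2 ≠ 0 := Nat.pos_iff_ne_zero.mp (by have := hE (show (0:Fin 4) < 2 by decide); omega)
    have h3' : e 3 ≠ 0 := Nat.pos_iff_ne_zero.mp (by have := hE (show (0:Fin 4) < 3 by decide); omega)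
    simp [zero_pow h1', zero_pow h2', zero_pow h3']
  have hQne : Q ≠ 0 := by
    intro h; rw [h, eval_zero] at hQ0; linarith
  -- at most one positive root of `Q`, with multiplicity
  have hcount : Q.roots.countP (fun t => 0 < t) ≤ 1 := by
    rcases h23 with ⟨h2, h3⟩ | ⟨h2, h3⟩
    · exact countP_posRoots_fewnomial_four_le_one w e hE h0.le h1 h2 h3.le
    · exact countP_posRoots_fewnomial_four_le_one_ttff e w hE h0.le h1 h2.le h3
  -- an explicit point where `Q < 0`, beyond any given `y`
  have hfar : ∀ y : ℝ, ∃ x : ℝ, y < x ∧ 0 < x ∧ Q.eval x < 0 := by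
    intro y
    -- dilate: `Q(s·x₀) = Σ (w l s^{e l}) x₀^{e l}` and use the explicit point `x₀ ≥ 1` for the dilated coefficients
    rcases h23 with ⟨h2, h3⟩ | ⟨h2, h3⟩
    · set s : ℝ := max 1 (y + 1) with hs
      have hs1 : 1 ≤ s := le_max_left _ _
      have hs0 : 0 < s := by linarith
      set w' : Fin 4 → ℝ := fun l => w l * s ^ e l with hw'
      have h3' : w' 3 < 0 := by
        simp only [hw']; exact mul_neg_of_neg_of_pos h3 (pow_pos hs0 _)
      have hneg := eval_lt_zero_of_top_neg w' e hE h3'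
      set x₀ : ℝ := 1 + (|w' 0| + |w' 1| + |w' 2|) / (-w' 3) with hx₀
      have hx₀1 : 1 ≤ x₀ := by
        have : 0 ≤ (|w' 0| + |w' 1| + |w' 2|) / (-w' 3) := div_nonneg (by positivity) (by linarith)
        linarith
      refine ⟨s * x₀, ?_, by positivity, ?_⟩
      · calc y < y + 1 := by linarith
          _ ≤ s := le_max_right _ _
          _ = s * 1 := (mul_one s).symm
          _ ≤ s * x₀ := mul_le_mul_of_nonneg_left hx₀1 hs0.le
      · -- `Q(s·x₀) = Σ w l (s x₀)^{e l} = Σ w' l x₀^{e l}`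
        have : Q.eval (s * x₀) = (∑ l, C (w' l) * (X : ℝ[X]) ^ e l).eval x₀ := by
          rw [hQ, eval_fewnomial, eval_fewnomial]
          refine Finset.sum_congr rfl fun l _ => ?_
          simp only [hw']; rw [mul_pow]; ring
        rw [this]; exact hneg
    · set s : ℝ := max 1 (y + 1) with hs
      have hs1 : 1 ≤ s := le_max_left _ _
      have hs0 : 0 < s := by linarith
      set w' : Fin 4 → ℝ := fun l => w l * s ^ e l with hw'
      have h2' : w' 2 < 0 := by
        simp only [hw']; exact mul_neg_of_neg_of_pos h2 (pow_pos hs0 _)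
      have h3' : w' 3 ≤ 0 := by
        simp only [hw']; exact mul_nonpos_of_nonpos_of_nonneg h3 (pow_nonneg hs0.le _)
      have hneg := eval_lt_zero_of_third_neg w' e hE h2' h3'
      set x₀ : ℝ := 1 + (|w' 0| + |w' 1|) / (-w' 2) with hx₀
      have hx₀1 : 1 ≤ x₀ := by
        have : 0 ≤ (|w' 0| + |w' 1|) / (-w' 2) := div_nonneg (by positivity) (by linarith)
        linarith
      refine ⟨s * x₀, ?_, by positivity, ?_⟩
      · calc y < y + 1 := by linarith
          _ ≤ s := le_max_right _ _
          _ = s * 1 := (mul_one s).symm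
          _ ≤ s * x₀ := mul_le_mul_of_nonneg_left hx₀1 hs0.le
      · have : Q.eval (s * x₀) = (∑ l, C (w' l) * (X : ℝ[X]) ^ e l).eval x₀ := by
          rw [hQ, eval_fewnomial, eval_fewnomial]
          refine Finset.sum_congr rfl fun l _ => ?_
          simp only [hw']; rw [mul_pow]; ring
        rw [this]; exact hneg
  -- IVT: a root of `Q` in `(0, x₁)`
  have hcont : Continuous fun t : ℝ => Q.eval t := Q.continuous
  obtain ⟨x₁, -, hx₁0, hQx₁⟩ := hfar 0
  have hIVT := intermediate_value_Ioo' hx₁0.le hcont.continuousOn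
  have h0mem : (0 : ℝ) ∈ Set.Ioo (Q.eval x₁) (Q.eval 0) := ⟨hQx₁, by rw [hQ0]; exact h0⟩
  obtain ⟨ρ, ⟨hρ0, hρ1⟩, hQρ''⟩ := hIVT h0mem
  have hQρ : Q.eval ρ = 0 := hQρ''
  -- uniqueness of the positive root
  have huniq : ∀ z : ℝ, 0 < z → Q.eval z = 0 → z = ρ := by
    intro z hz hQz
    by_contra hne
    have := two_le_countP_posRoots_of_two_roots Q hQne hz hρ0 hne hQz hQρ
    omega
  refine ⟨ρ, hρ0, by rw [hevalP, hQρ, mul_zero], ?_, ?_⟩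
  · -- `P > 0` on `(0, ρ)`
    intro x hx hxρ
    rw [hevalP]
    refine mul_pos (pow_pos hx _) ?_
    by_contra hle
    rcases lt_or_eq_of_le (not_lt.mp hle) with hlt | heq
    · -- a root in `(0, x)`, distinct from `ρ`
      have hIVT' := intermediate_value_Ioo' hx.le hcont.continuousOn
      have hmem : (0 : ℝ) ∈ Set.Ioo (Q.eval x) (Q.eval 0) := ⟨hlt, by rw [hQ0]; exact h0⟩
      obtain ⟨z, ⟨hz0, hzx⟩, hQz''⟩ := hIVT' hmem
      have hQz : Q.eval z = 0 := hQz''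
      have := huniq z hz0 hQz
      linarith
    · have := huniq x hx heq
      linarith
  · -- `P < 0` on `(ρ, ∞)`
    intro x hρx
    have hx : 0 < x := lt_trans hρ0 hρx
    rw [hevalP]
    refine mul_neg_of_pos_of_neg (pow_pos hx _) ?_
    by_contra hge
    rcases lt_or_eq_of_le (not_lt.mp hge) with hlt | heq
    · -- `Q(x) > 0`: a root in `(x, x₂)` with `Q(x₂) < 0`, distinct from `ρ`
      obtain ⟨x₂, hxx₂, -, hQx₂⟩ := hfar x
      have hIVT' := intermediate_value_Ioo' hxx₂.le hcont.continuousOn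
      have hmem : (0 : ℝ) ∈ Set.Ioo (Q.eval x₂) (Q.eval x) := ⟨hQx₂, hlt⟩
      obtain ⟨z, ⟨hzx, _⟩, hQz''⟩ := hIVT' hmem
      have hQz : Q.eval z = 0 := hQz''
      have := huniq z (lt_trans hx hzx) hQz
      linarith
    · have := huniq x hx heq.symm
      linarith

/-! ## §3 The poles `ρ₁, ρ₂, ρ₃` on the fully alternating cell -/

section Cell

variable (u v : Fin 4 → ℝ) (d : Fin 4 → ℕ)

/-- ★ **`U₁ = v₁u − u₁v` has a unique positive root `ρ₁`, with `p₀₁·U₁ > 0` on `(0,ρ₁)` and `< 0` on `(ρ₁,∞)`.** [this work] -/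
theorem special_one_root_structure (hd : StrictMono d)
    (h1 : (u 0 * v 1 - u 1 * v 0) * (u 0 * v 2 - u 2 * v 0) < 0) (h2 : (u 0 * v 2 - u 2 * v 0) * (u 0 * v 3 - u 3 * v 0) < 0)
    (h3 : (u 0 * v 3 - u 3 * v 0) * (u 1 * v 2 - u 2 * v 1) < 0) (h4 : (u 1 * v 2 - u 2 * v 1) * (u 1 * v 3 - u 3 * v 1) < 0)
    (h5 : (u 1 * v 3 - u 3 * v 1) * (u 2 * v 3 - u 3 * v 2) < 0) :
    ∃ ρ : ℝ, 0 < ρ ∧ (∑ l, C (u l * v 1 - u 1 * v l) * (X : ℝ[X]) ^ d l).eval ρ = 0 ∧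
      (∀ x : ℝ, 0 < x → x < ρ → 0 < (u 0 * v 1 - u 1 * v 0) * (∑ l, C (u l * v 1 - u 1 * v l) * (X : ℝ[X]) ^ d l).eval x) ∧
      (∀ x : ℝ, ρ < x → (u 0 * v 1 - u 1 * v 0) * (∑ l, C (u l * v 1 - u 1 * v l) * (X : ℝ[X]) ^ d l).eval x < 0) := by
  obtain ⟨hA, hB, hC, hne12⟩ := cell_signs u v h1 h2 h3 h4 h5
  have h13 : 0 < (u 0 * v 1 - u 1 * v 0) * (u 0 * v 3 - u 3 * v 0) := mul_pos_of_mul_neg_of_mul_neg h1 h2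
  have h01_13 : 0 < (u 0 * v 1 - u 1 * v 0) * (u 1 * v 3 - u 3 * v 1) := mul_pos_of_mul_neg_of_mul_neg hA h4
  have hne01 : (u 0 * v 1 - u 1 * v 0) ≠ 0 := by
    intro h; rw [h, zero_mul] at h1; exact lt_irrefl 0 h1
  set s := (u 0 * v 1 - u 1 * v 0) with hs
  -- scaled coefficients `s · p_{l1}`: `(s², 0, −s p₁₂, −s p₁₃)` — pattern `(+, 0, +, −)`
  set w : Fin 4 → ℝ := fun l => s * (u l * v 1 - u 1 * v l) with hw
  have hw0 : 0 < w 0 := by simp only [hw, hs]; exact mul_self_pos.mpr hne01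
  have hw1 : 0 ≤ w 1 := by simp only [hw]; nlinarith
  have hw2 : 0 ≤ w 2 := by
    simp only [hw]
    have e : s * (u 2 * v 1 - u 1 * v 2) = -((u 0 * v 1 - u 1 * v 0) * (u 1 * v 2 - u 2 * v 1)) := by rw [hs]; ring
    rw [e]; linarith
  have hw3 : w 3 < 0 := by
    simp only [hw]
    have e : s * (u 3 * v 1 - u 1 * v 3) = -((u 0 * v 1 - u 1 * v 0) * (u 1 * v 3 - u 3 * v 1)) := by rw [hs]; ring
    rw [e]; linarith
  obtain ⟨ρ, hρ, hroot, hbefore, hafter⟩ := fewnomial_four_unique_pos_root w d hd hw0 hw1 (Or.inl ⟨hw2, hw3⟩)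
  have hscale : ∀ x : ℝ, (∑ l, C (w l) * (X : ℝ[X]) ^ d l).eval x =
      s * (∑ l, C (u l * v 1 - u 1 * v l) * (X : ℝ[X]) ^ d l).eval x := by
    intro x
    rw [show (∑ l, C (w l) * (X : ℝ[X]) ^ d l) = C s * (∑ l, C (u l * v 1 - u 1 * v l) * (X : ℝ[X]) ^ d l) by
      rw [C_mul_fewnomial_four], eval_mul, eval_C]
  refine ⟨ρ, hρ, ?_, fun x hx hxρ => by rw [← hscale]; exact hbefore x hx hxρ, fun x hx => by rw [← hscale]; exact hafter x hx⟩
  have := hroot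
  rw [hscale] at this
  rcases mul_eq_zero.mp this with h | h
  · exact absurd h hne01
  · exact h

/-- ★ **`U₂ = v₂u − u₂v` has a unique positive root `ρ₂`, with `p₀₂·U₂ > 0` on `(0,ρ₂)` and `< 0` on `(ρ₂,∞)`.** [this work] -/
theorem special_two_root_structure (hd : StrictMono d)
    (h1 : (u 0 * v 1 - u 1 * v 0) * (u 0 * v 2 - u 2 * v 0) < 0) (h2 : (u 0 * v 2 - u 2 * v 0) * (u 0 * v 3 - u 3 * v 0) < 0)
    (h3 : (u 0 * v 3 - u 3 * v 0) * (u 1 * v 2 - u 2 * v 1) < 0) (h4 : (u 1 * v 2 - u 2 * v 1) * (u 1 * v 3 - u 3 * v 1) < 0)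
    (h5 : (u 1 * v 3 - u 3 * v 1) * (u 2 * v 3 - u 3 * v 2) < 0) :
    ∃ ρ : ℝ, 0 < ρ ∧ (∑ l, C (u l * v 2 - u 2 * v l) * (X : ℝ[X]) ^ d l).eval ρ = 0 ∧
      (∀ x : ℝ, 0 < x → x < ρ → 0 < (u 0 * v 2 - u 2 * v 0) * (∑ l, C (u l * v 2 - u 2 * v l) * (X : ℝ[X]) ^ d l).eval x) ∧
      (∀ x : ℝ, ρ < x → (u 0 * v 2 - u 2 * v 0) * (∑ l, C (u l * v 2 - u 2 * v l) * (X : ℝ[X]) ^ d l).eval x < 0) := by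
  obtain ⟨h03_13, h03_23, h02_23, h12_23, h02_12, hne23, hne13⟩ := cell_signs' u v h1 h2 h3 h4 h5
  have hne02 : (u 0 * v 2 - u 2 * v 0) ≠ 0 := by
    intro h; rw [h, zero_mul] at h2; exact lt_irrefl 0 h2
  set s := (u 0 * v 2 - u 2 * v 0) with hs
  -- scaled coefficients `s · p_{l2}`: `(s², s p₁₂, 0, −s p₂₃)` — pattern `(+, +, 0, −)`
  set w : Fin 4 → ℝ := fun l => s * (u l * v 2 - u 2 * v l) with hw
  have hw0 : 0 < w 0 := by simp only [hw, hs]; exact mul_self_pos.mpr hne02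
  have hw1 : 0 ≤ w 1 := by simp only [hw, hs]; exact h02_12.le
  have hw2 : 0 ≤ w 2 := by simp only [hw]; nlinarith
  have hw3 : w 3 < 0 := by
    simp only [hw]
    have e : s * (u 3 * v 2 - u 2 * v 3) = -((u 0 * v 2 - u 2 * v 0) * (u 2 * v 3 - u 3 * v 2)) := by rw [hs]; ring
    rw [e]; linarith
  obtain ⟨ρ, hρ, hroot, hbefore, hafter⟩ := fewnomial_four_unique_pos_root w d hd hw0 hw1 (Or.inl ⟨hw2, hw3⟩)
  have hscale : ∀ x : ℝ, (∑ l, C (w l) * (X : ℝ[X]) ^ d l).eval x =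
      s * (∑ l, C (u l * v 2 - u 2 * v l) * (X : ℝ[X]) ^ d l).eval x := by
    intro x
    rw [show (∑ l, C (w l) * (X : ℝ[X]) ^ d l) = C s * (∑ l, C (u l * v 2 - u 2 * v l) * (X : ℝ[X]) ^ d l) by
      rw [C_mul_fewnomial_four], eval_mul, eval_C]
  refine ⟨ρ, hρ, ?_, fun x hx hxρ => by rw [← hscale]; exact hbefore x hx hxρ, fun x hx => by rw [← hscale]; exact hafter x hx⟩
  have := hroot
  rw [hscale] at this
  rcases mul_eq_zero.mp this with h | h
  · exact absurd h hne02
  · exact h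

/-- ★ **`U₃ = v₃u − u₃v` has a unique positive root `ρ₃`, with `p₀₃·U₃ > 0` on `(0,ρ₃)` and `< 0` on `(ρ₃,∞)`.** [this work] -/
theorem special_three_root_structure (hd : StrictMono d)
    (h1 : (u 0 * v 1 - u 1 * v 0) * (u 0 * v 2 - u 2 * v 0) < 0) (h2 : (u 0 * v 2 - u 2 * v 0) * (u 0 * v 3 - u 3 * v 0) < 0)
    (h3 : (u 0 * v 3 - u 3 * v 0) * (u 1 * v 2 - u 2 * v 1) < 0) (h4 : (u 1 * v 2 - u 2 * v 1) * (u 1 * v 3 - u 3 * v 1) < 0)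
    (h5 : (u 1 * v 3 - u 3 * v 1) * (u 2 * v 3 - u 3 * v 2) < 0) :
    ∃ ρ : ℝ, 0 < ρ ∧ (∑ l, C (u l * v 3 - u 3 * v l) * (X : ℝ[X]) ^ d l).eval ρ = 0 ∧
      (∀ x : ℝ, 0 < x → x < ρ → 0 < (u 0 * v 3 - u 3 * v 0) * (∑ l, C (u l * v 3 - u 3 * v l) * (X : ℝ[X]) ^ d l).eval x) ∧
      (∀ x : ℝ, ρ < x → (u 0 * v 3 - u 3 * v 0) * (∑ l, C (u l * v 3 - u 3 * v l) * (X : ℝ[X]) ^ d l).eval x < 0) := by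
  obtain ⟨h03_13, h03_23, h02_23, h12_23, h02_12, hne23, hne13⟩ := cell_signs' u v h1 h2 h3 h4 h5
  have hne03 : (u 0 * v 3 - u 3 * v 0) ≠ 0 := by
    intro h; rw [h, zero_mul] at h03_13; exact lt_irrefl 0 h03_13
  set s := (u 0 * v 3 - u 3 * v 0) with hs
  -- scaled coefficients `s · p_{l3}`: `(s², s p₁₃, s p₂₃, 0)` — pattern `(+, +, −, 0)`
  set w : Fin 4 → ℝ := fun l => s * (u l * v 3 - u 3 * v l) with hw
  have hw0 : 0 < w 0 := by simp only [hw, hs]; exact mul_self_pos.mpr hne03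
  have hw1 : 0 ≤ w 1 := by simp only [hw, hs]; exact h03_13.le
  have hw2 : w 2 < 0 := by simp only [hw, hs]; exact h03_23
  have hw3 : w 3 ≤ 0 := by simp only [hw]; nlinarith
  obtain ⟨ρ, hρ, hroot, hbefore, hafter⟩ := fewnomial_four_unique_pos_root w d hd hw0 hw1 (Or.inr ⟨hw2, hw3⟩)
  have hscale : ∀ x : ℝ, (∑ l, C (w l) * (X : ℝ[X]) ^ d l).eval x =
      s * (∑ l, C (u l * v 3 - u 3 * v l) * (X : ℝ[X]) ^ d l).eval x := by
    intro x
    rw [show (∑ l, C (w l) * (X : ℝ[X]) ^ d l) = C s * (∑ l, C (u l * v 3 - u 3 * v l) * (X : ℝ[X]) ^ d l) by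
      rw [C_mul_fewnomial_four], eval_mul, eval_C]
  refine ⟨ρ, hρ, ?_, fun x hx hxρ => by rw [← hscale]; exact hbefore x hx hxρ, fun x hx => by rw [← hscale]; exact hafter x hx⟩
  have := hroot
  rw [hscale] at this
  rcases mul_eq_zero.mp this with h | h
  · exact absurd h hne03
  · exact h

end Cell

end WronskianDevelopable

end Summit.ValiantsHypothesis.ValiantsHypothesis.Theorems.KPlusLogSqLaw.TowerGraft
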